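import Summits.Ventures.Crystal3D.Theorems.StickyWulffConstantGenericWallFloorStackWalkWordSep
import HarnessLib

/-!
# TWIN GRAINS APART: a stack frame over `⟨A, u, 0⟩` and one over the basal twin `⟨twinFrame A (A e₃), u, 0⟩` (`u` in-plane) are
# co-axial only when both are the bottoms (crux `GenericWallFloor`, stmt-Ventures-19480, kernel G; LAYER ROWS R1 step (iii-a), cf-p1 (ccxi)/(ccxiii);
# the word criterion `not_coaxial_of_word` of `…StackWalkWordSep` at word length ONE, with the refined conclusion)

HONEST FRAMING. Venture `Summits/Ventures/Crystal3D` (cell `crystal3d-full`), route `route-Ventures-StickyWulffConstant`, helper for the crux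
`GenericWallFloor` (stmt-Ventures-19480) / consumer `TextureLiminfV5` (stmt-Ventures-23912).  Pure stack-walk algebra on landed pieces (the
word half: `frame_eq_wordFrame`, `map_reflection_eq_of_image_eq` resting on NonReturn, `eq_or_twin_of_coaxial`); no inputs; F-C1 not moved; NOT R1.

THE POINT.  The in-layer rows of ONE plate are walked by TWO stack grains: bottom `⟨A, u, 0⟩` on the «++» c-layers and bottom
`⟨G, u, 0⟩`, `G = twinFrame A (A e₃)` (the basal twin; `G u = A u` for the in-plane row slot `u`), on the «−−» c-layers.  The per-ball count
of coincident ends (`card_contacts_add_endStates_le_twelve_cross`) needs, for a grain-1 state and a grain-2 state at one ball, NON-co-axial top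
frames — and `A`, `G` themselves ARE co-axial.  This file shows that the base pair is the ONLY co-axial cross pair:

**`bottoms_of_coaxial_twinGrains`** — `u` a slot with `u₂ = 0`; `stk₁` a sound well-formed stack over `⟨A, u, 0⟩`, `stk₂` one over `⟨G, u, 0⟩`;
entries `e₁ ∈ stk₁`, `e₂ ∈ stk₂` with co-axial frames.  Then `e₁ = ⟨A, u, 0⟩` and `e₂ = ⟨G, u, 0⟩`.
Mechanism (verbatim the skeleton of `not_coaxial_of_word` with `κ = [e₃]`, `G = wordFrame A [e₃]`): both frames are word frames over `A` — the far
one, transported through the lattice symmetry `S = G⁻¹ ∘ … `, is `β.map S ++ [e₃]` with `β` the far stack word; co-axial lattices are equal or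
once-more-reflected; reduced menu words with one slot dozen have one mirror sequence; the near word is empty or ENDS WITH A LETTER POSITIVE ON `u`
(the first push normal), the far word ends with `e₃ ⊥ u`.  So the mirror sequences can only agree when the far stack word `β` is empty and the near
word is empty too — the one extra mirror being the basal one: both entries are the bottoms.  (Numerics before typing, `calc/tg_cross.py`: 120 Haar
edge-on frames × both forced rays of both grains to depth 6 — the only co-axial cross pair is `(A, G)`.)
* `wordFrame_singleton_e₃` (`twinFrame A (A e₃) = wordFrame A [e₃]`), `e₃_modelMenu`; `eq_bottom_of_stackWord_eq_nil`;
  **`bottoms_of_coaxial_twinGrains`**.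
WHAT THIS IS NOT: not the certificate clash of the two bottoms at one ball (next file), not the count; F-C1 not moved.
-/

noncomputable section

namespace Summit.Ventures.Crystal3D.Theorems

open Summit.Ventures.Crystal3D Finset
open Literature.MathematicalPhysics.StatisticalMechanics (fccStacking barlowStacking IsHaggSeq)
open scoped InnerProductSpace

/-! ### The basal twin as a one-letter word -/

/-- `e₃` is a unit model menu normal. -/
theorem e₃_modelMenu :
    ‖(EuclideanSpace.single (2 : Fin 3) (1 : ℝ) : EuclideanSpace ℝ (Fin 3))‖ = 1 ∧
      ∀ w ∈ fccSlots, ⟪w, EuclideanSpace.single (2 : Fin 3) (1 : ℝ)⟫_ℝ = 0 ∨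
        ⟪w, EuclideanSpace.single (2 : Fin 3) (1 : ℝ)⟫_ℝ = Real.sqrt (2 / 3) ∨
        ⟪w, EuclideanSpace.single (2 : Fin 3) (1 : ℝ)⟫_ℝ = -Real.sqrt (2 / 3) := by
  refine ⟨by rw [PiLp.norm_single, norm_one], fun w hw => ?_⟩
  rw [EuclideanSpace.inner_single_right]
  simpa using slot_apply_two_cases hw

/-- **The basal twin frame is the one-letter word `[e₃]` over `A`.** -/
theorem wordFrame_singleton_e₃ (A : EuclideanSpace ℝ (Fin 3) ≃ₗᵢ[ℝ] EuclideanSpace ℝ (Fin 3)) :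
    twinFrame A (A (EuclideanSpace.single (2 : Fin 3) (1 : ℝ))) = wordFrame A [EuclideanSpace.single (2 : Fin 3) (1 : ℝ)] := by
  have hn : ‖A (EuclideanSpace.single (2 : Fin 3) (1 : ℝ))‖ = 1 := by
    rw [LinearIsometryEquiv.norm_map, e₃_modelMenu.1]
  rw [twinFrame_eq_reflection_trans A hn, LinearIsometryEquiv.symm_apply_apply, wordFrame_cons]
  rfl

/-- The basal twin frame moves the in-plane slot like `A`: `twinFrame A (A e₃) u = A u` for `u₂ = 0`. -/
theorem twinFrame_basal_apply_inPlane (A : EuclideanSpace ℝ (Fin 3) ≃ₗᵢ[ℝ] EuclideanSpace ℝ (Fin 3))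
    {u : EuclideanSpace ℝ (Fin 3)} (hu2 : u 2 = 0) :
    twinFrame A (A (EuclideanSpace.single (2 : Fin 3) (1 : ℝ))) u = A u := by
  have hn : ‖A (EuclideanSpace.single (2 : Fin 3) (1 : ℝ))‖ = 1 := by
    rw [LinearIsometryEquiv.norm_map, e₃_modelMenu.1]
  rw [twinFrame_apply A hn, LinearIsometryEquiv.inner_map_map, EuclideanSpace.inner_single_right]
  simp [hu2]

/-- A sound stack whose word is empty is the singleton of its bottom. -/
theorem eq_bottom_of_stackWord_eq_nil {e b : WalkEntry} :
    ∀ {r : List WalkEntry}, stackWord (e :: r) = [] → (e :: r).getLast? = some b → e = b ∧ r = []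
  | [], _, hl => ⟨Option.some.inj (by simpa using hl), rfl⟩
  | e' :: rest, hw, _ => by simp at hw

/-! ### Twin grains apart -/

/-- **TWIN GRAINS APART.**  See the module docstring. -/
theorem bottoms_of_coaxial_twinGrains {A : EuclideanSpace ℝ (Fin 3) ≃ₗᵢ[ℝ] EuclideanSpace ℝ (Fin 3)}
    {u : EuclideanSpace ℝ (Fin 3)} (hu2 : u 2 = 0)
    {z₁ z₂ : EuclideanSpace ℝ (Fin 3)} {stk₁ stk₂ : List WalkEntry}
    (hS₁ : StackSound z₁ stk₁) (hW₁ : StackWF z₁ stk₁) (hl₁ : stk₁.getLast? = some ⟨A, u, 0⟩)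
    (hS₂ : StackSound z₂ stk₂) (hW₂ : StackWF z₂ stk₂)
    (hl₂ : stk₂.getLast? = some ⟨twinFrame A (A (EuclideanSpace.single (2 : Fin 3) (1 : ℝ))), u, 0⟩)
    {e₁ e₂ : WalkEntry} (he₁ : e₁ ∈ stk₁) (he₂ : e₂ ∈ stk₂)
    (hco : ∃ (L : EuclideanSpace ℝ (Fin 3) ≃ₗᵢ[ℝ] EuclideanSpace ℝ (Fin 3))
        (s₁ s₂ : EuclideanSpace ℝ (Fin 3)) (σ σ' : ℤ → ℤ), IsHaggSeq σ ∧ IsHaggSeq σ' ∧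
        e₁.frame '' fccStacking 1 (Real.sqrt (2 / 3)) ⊆ (fun p => L p + s₁) '' barlowStacking 1 (Real.sqrt (2 / 3)) σ ∧
        e₂.frame '' fccStacking 1 (Real.sqrt (2 / 3)) ⊆ (fun p => L p + s₂) '' barlowStacking 1 (Real.sqrt (2 / 3)) σ') :
    e₁ = ⟨A, u, 0⟩ ∧ e₂ = ⟨twinFrame A (A (EuclideanSpace.single (2 : Fin 3) (1 : ℝ))), u, 0⟩ := by
  set e₃ : EuclideanSpace ℝ (Fin 3) := EuclideanSpace.single (2 : Fin 3) (1 : ℝ) with he₃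
  set G := twinFrame A (A e₃) with hG
  have hr : 0 < Real.sqrt (2 / 3) := Real.sqrt_pos.2 (by norm_num)
  obtain ⟨he₃u, he₃m⟩ := e₃_modelMenu
  have hGW : G = wordFrame A [e₃] := wordFrame_singleton_e₃ A
  have hGu : G u = A u := twinFrame_basal_apply_inPlane A hu2
  have hue₃ : ⟪u, e₃⟫_ℝ = 0 := by rw [he₃, EuclideanSpace.inner_single_right]; simp [hu2]
  -- suffixes with the given tops
  obtain ⟨r₁, hS₁', hW₁', hl₁'⟩ := exists_suffix_of_mem stk₁ e₁ he₁ hS₁ hW₁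
  obtain ⟨r₂, hS₂', hW₂', hl₂'⟩ := exists_suffix_of_mem stk₂ e₂ he₂ hS₂ hW₂
  rw [hl₁] at hl₁'
  rw [hl₂] at hl₂'
  -- the two stack words
  obtain ⟨hαl, hαc⟩ := stackWord_letters _ hS₁' hW₁'
  obtain ⟨hβl, hβc⟩ := stackWord_letters _ hS₂' hW₂'
  have hF₁ : e₁.frame = wordFrame A (stackWord (e₁ :: r₁)) := by
    rw [frame_eq_wordFrame e₁ r₁ hS₁', stackBase_eq_of_getLast? hl₁']
  have hF₂ : e₂.frame = wordFrame G (stackWord (e₂ :: r₂)) := by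
    rw [frame_eq_wordFrame e₂ r₂ hS₂', stackBase_eq_of_getLast? hl₂']
  have hαpos : ∀ μ, (stackWord (e₁ :: r₁)).getLast? = some μ → ⟪u, μ⟫_ℝ = Real.sqrt (2 / 3) :=
    fun μ hμ => inner_dir_getLast_stackWord r₁ e₁ ⟨A, u, 0⟩ hS₁' hl₁' μ hμ
  have hβpos : ∀ μ, (stackWord (e₂ :: r₂)).getLast? = some μ → ⟪u, μ⟫_ℝ = Real.sqrt (2 / 3) :=
    fun μ hμ => inner_dir_getLast_stackWord r₂ e₂ ⟨G, u, 0⟩ hS₂' hl₂' μ hμ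
  -- the conclusion from two empty words
  have hgoal : stackWord (e₁ :: r₁) = [] → stackWord (e₂ :: r₂) = [] →
      e₁ = ⟨A, u, 0⟩ ∧ e₂ = ⟨twinFrame A (A (EuclideanSpace.single (2 : Fin 3) (1 : ℝ))), u, 0⟩ :=
    fun h₁ h₂ => ⟨(eq_bottom_of_stackWord_eq_nil h₁ hl₁').1, (eq_bottom_of_stackWord_eq_nil h₂ hl₂').1⟩
  -- the lattice symmetry `S = G⁻¹ ∘ G`... : here simply `S = G.trans (wordFrame A [e₃]).symm`
  obtain ⟨S, hS⟩ : ∃ S : EuclideanSpace ℝ (Fin 3) ≃ₗᵢ[ℝ] EuclideanSpace ℝ (Fin 3),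
      S = G.trans (wordFrame A [e₃]).symm := ⟨_, rfl⟩
  have hWS : ∀ x, wordFrame A [e₃] (S x) = G x := fun x => by
    rw [hS, LinearIsometryEquiv.trans_apply, LinearIsometryEquiv.apply_symm_apply]
  have hGeq : G = S.trans (wordFrame A [e₃]) :=
    LinearIsometryEquiv.ext fun x => by rw [LinearIsometryEquiv.trans_apply, hWS]
  have hSfcc : S '' fccStacking 1 (Real.sqrt (2 / 3)) = fccStacking 1 (Real.sqrt (2 / 3)) := by
    rw [hS, LinearIsometryEquiv.coe_trans, Set.image_comp, hGW, Set.image_image]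
    simp
  have hSslots := image_fccSlots_eq_self_of_image_fcc S hSfcc
  have hSmem' : ∀ w ∈ fccSlots, S.symm w ∈ fccSlots := fun w hw => by
    have hw' : w ∈ (S : EuclideanSpace ℝ (Fin 3) → EuclideanSpace ℝ (Fin 3)) '' ↑fccSlots := by
      rw [hSslots]; exact Finset.mem_coe.2 hw
    obtain ⟨w', hw', hw'eq⟩ := hw'
    rw [← hw'eq, LinearIsometryEquiv.symm_apply_apply]; exact Finset.mem_coe.1 hw'
  -- the transported far word `γ = (β.map S) ++ [e₃]`
  set β := stackWord (e₂ :: r₂) with hβ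
  have hβSl : ∀ μ ∈ β.map S, ‖μ‖ = 1 ∧
      ∀ w ∈ fccSlots, ⟪w, μ⟫_ℝ = 0 ∨ ⟪w, μ⟫_ℝ = Real.sqrt (2 / 3) ∨ ⟪w, μ⟫_ℝ = -Real.sqrt (2 / 3) := by
    intro μ hμ
    obtain ⟨ν, hν, rfl⟩ := List.mem_map.1 hμ
    obtain ⟨hνu, hνm⟩ := hβl ν hν
    refine ⟨by rw [LinearIsometryEquiv.norm_map, hνu], fun w hw => ?_⟩
    have hsw : ⟪w, S ν⟫_ℝ = ⟪S.symm w, ν⟫_ℝ := by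
      rw [← LinearIsometryEquiv.inner_map_map S (S.symm w) ν, LinearIsometryEquiv.apply_symm_apply]
    rw [hsw]; exact hνm _ (hSmem' w hw)
  have hβSc : List.IsChain (fun μ μ' => ⟪μ, μ'⟫_ℝ = 1 / 3 ∨ ⟪μ, μ'⟫_ℝ = -1 / 3) (β.map S) := by
    rw [List.isChain_map]; simpa only [LinearIsometryEquiv.inner_map_map] using hβc
  have hκl : ∀ μ ∈ [e₃], ‖μ‖ = 1 ∧
      ∀ w ∈ fccSlots, ⟪w, μ⟫_ℝ = 0 ∨ ⟪w, μ⟫_ℝ = Real.sqrt (2 / 3) ∨ ⟪w, μ⟫_ℝ = -Real.sqrt (2 / 3) := by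
    intro μ hμ; rw [List.mem_singleton] at hμ; subst hμ; exact ⟨he₃u, he₃m⟩
  have hγl : ∀ μ ∈ β.map S ++ [e₃], ‖μ‖ = 1 ∧
      ∀ w ∈ fccSlots, ⟪w, μ⟫_ℝ = 0 ∨ ⟪w, μ⟫_ℝ = Real.sqrt (2 / 3) ∨ ⟪w, μ⟫_ℝ = -Real.sqrt (2 / 3) := by
    intro μ hμ
    rcases List.mem_append.1 hμ with h | h
    · exact hβSl μ h
    · exact hκl μ h
  have hγc : List.IsChain (fun μ μ' => ⟪μ, μ'⟫_ℝ = 1 / 3 ∨ ⟪μ, μ'⟫_ℝ = -1 / 3) (β.map S ++ [e₃]) := by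
    rw [List.isChain_append]
    refine ⟨hβSc, List.isChain_singleton _, fun x hx y hy => ?_⟩
    rw [List.getLast?_map, Option.mem_def, Option.map_eq_some_iff] at hx
    obtain ⟨ν, hν, rfl⟩ := hx
    rw [List.head?_cons, Option.mem_def, Option.some.injEq] at hy
    subst hy
    obtain ⟨hxu, hxm⟩ := hβSl (S ν) (List.mem_map.2 ⟨ν, List.mem_of_getLast? hν, rfl⟩)
    -- the junction: `S ν` is positive on `S u`, `e₃` is orthogonal to it
    have hpos : ⟪S u, S ν⟫_ℝ = Real.sqrt (2 / 3) := by rw [LinearIsometryEquiv.inner_map_map]; exact hβpos ν hν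
    have horth : ⟪S u, e₃⟫_ℝ = 0 := by
      rw [← LinearIsometryEquiv.inner_map_map (wordFrame A [e₃]), hWS, ← hGW, hG, LinearIsometryEquiv.inner_map_map]
      exact hue₃
    rcases inner_modelMenu hxu he₃u hxm he₃m with h | h | h | h
    · have heq : S ν = e₃ := (inner_eq_one_iff_of_norm_eq_one (𝕜 := ℝ) hxu he₃u).1 h
      rw [heq, horth] at hpos; exact absurd hpos (ne_of_lt hr)
    · have heq : e₃ = -S ν := eq_neg_of_inner_eq_neg_one' hxu he₃u h
      rw [heq, inner_neg_right, hpos] at horth; linarith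
    · exact Or.inl h
    · exact Or.inr h
  have hγlast : (β.map S ++ [e₃]).getLast? = some e₃ := by simp
  -- the far frame's slot dozen as a word over `A`
  have himg₂ : (e₂.frame : EuclideanSpace ℝ (Fin 3) → EuclideanSpace ℝ (Fin 3)) '' ↑fccSlots =
      (wordFrame A (β.map S ++ [e₃]) : EuclideanSpace ℝ (Fin 3) → EuclideanSpace ℝ (Fin 3)) '' ↑fccSlots := by
    rw [hF₂, hGeq, wordFrame_trans (wordFrame A [e₃]) S β (fun μ hμ => (hβl μ hμ).1), ← wordFrame_append,
      image_trans_eq, hSslots]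
  -- the main step: a word over `A` with a POSITIVE last letter (or empty) having the far word's mirror sequence is absurd
  have main : ∀ α : List (EuclideanSpace ℝ (Fin 3)),
      (∀ μ ∈ α, ‖μ‖ = 1 ∧
        ∀ w ∈ fccSlots, ⟪w, μ⟫_ℝ = 0 ∨ ⟪w, μ⟫_ℝ = Real.sqrt (2 / 3) ∨ ⟪w, μ⟫_ℝ = -Real.sqrt (2 / 3)) →
      List.IsChain (fun μ μ' => ⟪μ, μ'⟫_ℝ = 1 / 3 ∨ ⟪μ, μ'⟫_ℝ = -1 / 3) α →
      (∀ lam, α.getLast? = some lam → ⟪u, lam⟫_ℝ = Real.sqrt (2 / 3)) →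
      (wordFrame A α : EuclideanSpace ℝ (Fin 3) → EuclideanSpace ℝ (Fin 3)) '' ↑fccSlots =
        (wordFrame A (β.map S ++ [e₃]) : EuclideanSpace ℝ (Fin 3) → EuclideanSpace ℝ (Fin 3)) '' ↑fccSlots → False := by
    intro α hl hc hP himg
    have hmap := map_reflection_eq_of_image_eq A hl hc hγl hγc himg
    have hlast := congrArg List.getLast? hmap
    rw [List.getLast?_map, List.getLast?_map, hγlast, Option.map_some] at hlast
    cases hα : α.getLast? with
    | none => rw [hα] at hlast; simp at hlast
    | some lam =>
      rw [hα, Option.map_some, Option.some.injEq] at hlast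
      have hlamu : ‖lam‖ = 1 := (hl lam (List.mem_of_getLast? hα)).1
      have hposlam := hP lam hα
      rcases eq_or_eq_neg_of_reflection_eq hlamu he₃u hlast with h | h
      · rw [h, hue₃] at hposlam; exact absurd hposlam (ne_of_lt hr)
      · rw [h, inner_neg_right, hue₃, neg_zero] at hposlam; exact absurd hposlam (ne_of_lt hr)
  -- when the near word compared is EMPTY, the far word is `[e₃]` exactly: `β = []`
  have hβnil_of : ∀ m' : EuclideanSpace ℝ (Fin 3),
      ([m'].map (fun μ => (ℝ ∙ μ)ᗮ.reflection) = (β.map S ++ [e₃]).map (fun μ => (ℝ ∙ μ)ᗮ.reflection)) → β = [] := by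
    intro m' hmap
    have hlen := congrArg List.length hmap
    simp only [List.length_map, List.length_singleton, List.length_append] at hlen
    exact List.eq_nil_of_length_eq_zero (by omega)
  rcases eq_or_twin_of_coaxial e₁.frame e₂.frame hco with hEq | ⟨m, hm, hmenu, hEq⟩
  · -- equal lattices: absurd (the near word is empty or ends positively, the far word ends with `e₃`)
    have himg := image_fccSlots_eq_of_image_fcc_eq _ _ hEq
    rw [hF₁, himg₂] at himg
    exact (main _ hαl hαc hαpos himg).elim
  · -- mirror twins: one more letter `m' = e₁.frame⁻¹ m` in front of the near word
    set m' := e₁.frame.symm m with hm'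
    have hm'u : ‖m'‖ = 1 := by rw [hm', LinearIsometryEquiv.norm_map, hm]
    have hm'm : ∀ w ∈ fccSlots, ⟪w, m'⟫_ℝ = 0 ∨ ⟪w, m'⟫_ℝ = Real.sqrt (2 / 3) ∨ ⟪w, m'⟫_ℝ = -Real.sqrt (2 / 3) := by
      intro w hw
      rw [hm', ← LinearIsometryEquiv.inner_map_map e₁.frame, LinearIsometryEquiv.apply_symm_apply]
      exact hmenu w hw
    have htw : twinFrame e₁.frame m = wordFrame A (m' :: stackWord (e₁ :: r₁)) := by
      rw [twinFrame_eq_reflection_trans e₁.frame hm, wordFrame_cons, ← hm', ← hF₁]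
    have himg := image_fccSlots_eq_of_image_fcc_eq _ _ hEq
    rw [himg₂, htw] at himg
    cases hα : stackWord (e₁ :: r₁) with
    | nil =>
      -- the near entry is the bottom; the far word must be empty too
      rw [hα] at himg
      have hl1 : ∀ μ ∈ [m'], ‖μ‖ = 1 ∧
          ∀ w ∈ fccSlots, ⟪w, μ⟫_ℝ = 0 ∨ ⟪w, μ⟫_ℝ = Real.sqrt (2 / 3) ∨ ⟪w, μ⟫_ℝ = -Real.sqrt (2 / 3) := by
        intro μ hμ; rw [List.mem_singleton] at hμ; rw [hμ]; exact ⟨hm'u, hm'm⟩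
      have hmap := map_reflection_eq_of_image_eq A hl1 (List.isChain_singleton _) hγl hγc himg.symm
      exact hgoal hα (hβnil_of m' hmap)
    | cons a α' =>
      rw [hα] at himg hαl hαc hαpos
      obtain ⟨hau, ham⟩ := hαl a List.mem_cons_self
      -- the tail keeps the positive last letter (when nonempty)
      have hPtail : ∀ lam, α'.getLast? = some lam → ⟪u, lam⟫_ℝ = Real.sqrt (2 / 3) := by
        intro lam hlam
        refine hαpos lam ?_
        cases α' with
        | nil => simp at hlam
        | cons b α'' => rw [List.getLast?_cons_cons]; exact hlam
      have hPfull : ∀ lam, (m' :: a :: α').getLast? = some lam → ⟪u, lam⟫_ℝ = Real.sqrt (2 / 3) := by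
        intro lam hlam
        rw [List.getLast?_cons_cons] at hlam
        exact hαpos lam hlam
      exfalso
      rcases inner_modelMenu hm'u hau hm'm ham with h | h | h | h
      · -- `m' = a`: the two mirrors cancel
        have hma : m' = a := (inner_eq_one_iff_of_norm_eq_one (𝕜 := ℝ) hm'u hau).1 h
        rw [wordFrame_cons_cons_cancel A (by rw [hma]) α'] at himg
        exact main α' (fun μ hμ => hαl μ (List.mem_cons_of_mem a hμ)) hαc.tail hPtail himg.symm
      · -- `m' = −a`: the same mirror, cancel again
        have hma : a = -m' := eq_neg_of_inner_eq_neg_one' hm'u hau h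
        have hR : (ℝ ∙ m')ᗮ.reflection = (ℝ ∙ a)ᗮ.reflection := by rw [hma, reflection_neg_eq hm'u]
        rw [wordFrame_cons_cons_cancel A hR α'] at himg
        exact main α' (fun μ hμ => hαl μ (List.mem_cons_of_mem a hμ)) hαc.tail hPtail himg.symm
      · exact main (m' :: a :: α') (fun μ hμ => by
            rcases List.mem_cons.1 hμ with rfl | hμ'
            · exact ⟨hm'u, hm'm⟩
            · exact hαl μ hμ')
          (List.isChain_cons.2 ⟨fun b hb => by
            rw [List.head?_cons, Option.mem_some_iff] at hb; rw [← hb]; exact Or.inl h, hαc⟩) hPfull himg.symm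
      · exact main (m' :: a :: α') (fun μ hμ => by
            rcases List.mem_cons.1 hμ with rfl | hμ'
            · exact ⟨hm'u, hm'm⟩
            · exact hαl μ hμ')
          (List.isChain_cons.2 ⟨fun b hb => by
            rw [List.head?_cons, Option.mem_some_iff] at hb; rw [← hb]; exact Or.inr h, hαc⟩) hPfull himg.symm

end Summit.Ventures.Crystal3D.Theorems

end
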